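/-
Origin: expansion seat `planner-pub-hodgecm-pv05-g3-0`, handover #8 v4 2026-08-18T07:02:46Z (`HOME/pub-hodgecm-pv05-g3/lean/Pv05g3/FockCommutant.lean`, md5 76baec2b, 327 lines);
landed by the gen-7 packager in gate run 25 as `HodgeCM/PerL34/FockCommutant.lean` (verbatim).
-/
/-
Origin: HOME/pub-hodgecm-pv05-g3/lean/Pv05g3/FockCommutant.lean — session planner-pub-hodgecm-pv05-g3-0 (unit pub-hodgecm-pv05-g3,
DAG-NODE PROVER #05 gen 3), 8th deliverable.  Intended final place: `HodgeCM/PerL34/FockCommutant.lean`, after this seat's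
`FockLattice.lean` (imports the LANDED `HodgeCM.PerL34.FockLattice`; no rewrite needed).  Imports
`Mathlib.Analysis.Complex.Polynomial.Basic` (for `IsAlgClosed ℂ`), `Mathlib.LinearAlgebra.Eigenspace.Triangularizable`
(for `Module.End.exists_eigenvalue`) + `HodgeCM.PerL34.FockLattice` only; nothing cited, nothing asserted, no hypotheses.
-/
import Mathlib.Analysis.Complex.Polynomial.Basic
import Mathlib.LinearAlgebra.Eigenspace.Triangularizable
import Summits.HodgeConjecture.HodgeCM.PerL34.FockLattice_2

set_option autoImplicit false

/-!
# Howe duality in double-commutant form for `(U(1), U(2,1))` on the Fock space — KERNEL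

Everything here is kernel-proved from the polynomial Fock model of `FockKTypes` / `FockIrreducible` / `FockGL3` /
`FockLattice`; no literature is invoked and no hypothesis is carried.  Honest label: KERNEL (model level).  What is
NOT proved here (DICTIONARY, see `GAPS.md` pv05g3-K1..K8): the identification of this polynomial model and of
`oscRep` with the printed oscillator representation.

Let `T : End_ℂ ℂ[z₁,z₂,w]` be any linear operator.  Main results (namespace `HodgeCM.PerL34.Fock`):

* `weightOp_uWt_eq : Z = E₀₀ + E₁₁ − H` and `weightOp_hwWt_eq` (the `U(1)` generator and the `w`-degree lie in
  `oscRep(𝔤𝔩₃) + ℂ·1`); `comm_osc`, `comm_hE`, `comm_hH`, `map_mem_hpiece`, `map_mem_wpiece_hwWt` (a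
  `𝔤𝔩₃`-commuting `T` preserves every `F_k` and every `w`-layer);
* `exists_eigenvector_mem_hpiece` (such a `T` has an eigenvector in `F_k`, found in the finite-dimensional non-zero
  layer `F_k ⊓ {w-degree = k⁻}` via `kpiece_finite` / `kpiece_ne_bot_iff` and algebraic closedness of `ℂ`);
* **`commutant_scalar_on_hpiece`** (Schur): a `𝔤𝔩₃`-commuting `T` acts on each irreducible `F_k` by a scalar —
  the eigen-submodule `F_k ⊓ ker (T − c)` is `𝔤𝔩₃`-stable and non-zero, hence all of `F_k` by
  `hpiece_le_of_oscRep_stable` (irreducibility, `FockIrreducible`/`FockGL3`);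
* `commutes_of_scalar_on_hpiece` (converse) and the headline
  **`commutant_iff (T) : (∀ A, T * oscRep A = oscRep A * T) ↔ ∃ c : ℤ → ℂ, ∀ k, ∀ f ∈ hpiece k, T f = c k • f`**:
  the commutant of `oscRep(𝔤𝔩₃(ℂ))` in `End ℂ[z₁,z₂,w]` is exactly the algebra of operators that are a scalar on each
  `U(1)`-isotypic piece `F_k`, i.e. the full (weakly closed) algebra generated by the `U(1)` action — the two actions
  are mutual commutants (Howe duality, double-commutant form, at module level), complementing the multiplicity-one
  decomposition `ℂ[z₁,z₂,w] = ⊕ₖ F_k` (`FockLieModule`), irreducibility and pairwise inequivalence of the `F_k`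
  (`FockIrreducible`, `FockGL3`, `FockLowestWeight`) and the submodule classification (`FockLattice`, `FockAtoms`);
* the definite pair `(U(1), U(3))` symmetrically: `weightOp_one_eq_def` (Euler operator `= E₀₀+E₁₁+E₂₂`), `comm_dE`,
  `map_mem_dpiece`, **`commutant_scalar_on_dpiece`** (Schur on `Sym^d`), `commutes_of_scalar_on_dpiece`,
  **`commutant_iff_def (T) : (∀ A, T * dERep A = dERep A * T) ↔ ∃ c : ℕ → ℂ, ∀ d, ∀ f ∈ dpiece d, T f = c d • f`**;
* multiplicity-freeness in commutant form: `commutant_commutative` / `commutant_commutative_def` (both commutants are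
  commutative algebras) and `weightOp_uWt_comm_oscRep` (the `U(1)` generator `Z` lies in the commutant, so the
  commutant of `𝔤𝔩₃` is the bicommutant of `U(1)`).
-/

namespace HodgeCM.PerL34.Fock
open MvPolynomial Finsupp

section Commutant
attribute [local instance 100] LieRing.ofAssociativeRing

/-- the `U(1)` weight operator lies in the image of `𝔤𝔩₃` up to the identity: `Z = E₀₀ + E₁₁ − H` -/
theorem weightOp_uWt_eq : (weightOp uWt : HarmModel →ₗ[ℂ] HarmModel) = hE 0 0 + hE 1 1 - hH := by
  apply LinearMap.ext
  intro f
  rw [weightOp_apply, Fintype.sum_sum_type, Fin.sum_univ_two, Fintype.sum_unique]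
  simp only [LinearMap.sub_apply, LinearMap.add_apply]
  simp only [uWt, hE_apply, hH_apply, Int.cast_one, one_smul, Int.cast_neg, neg_smul, sub_eq_add_neg]

/-- the `w`-degree operator is `H` -/
theorem weightOp_hwWt_eq : (weightOp hwWt : HarmModel →ₗ[ℂ] HarmModel) = hH := by
  apply LinearMap.ext
  intro f
  rw [weightOp_apply, Fintype.sum_sum_type, Fin.sum_univ_two, Fintype.sum_unique]
  simp only [hwWt, hH_apply, Int.cast_zero, zero_smul, zero_add, Int.cast_one, one_smul]

variable (T : Module.End ℂ HarmModel)

/-- an operator commuting with the image of `𝔤𝔩₃` commutes with each `osc i j` … -/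
theorem comm_osc (hT : ∀ A : Matrix HarmVar HarmVar ℂ, T * oscRep A = oscRep A * T) (i j : HarmVar) :
    T * osc i j = osc i j * T := by
  have h := hT (Matrix.single i j 1)
  rwa [oscRep_single] at h

/-- … with the polarisations `E_ab` … -/
theorem comm_hE (hT : ∀ A : Matrix HarmVar HarmVar ℂ, T * oscRep A = oscRep A * T) (a b : Fin 2) :
    T * hE a b = hE a b * T := by
  have h := comm_osc T hT (Sum.inl a) (Sum.inl b)
  simp only [osc] at h
  by_cases hab : a = b
  · subst hab
    simp only [if_true, mul_add, add_mul, mul_one, one_mul] at h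
    exact add_right_cancel h
  · simpa only [hab, if_false, add_zero] using h

/-- … and with `H`. -/
theorem comm_hH (hT : ∀ A : Matrix HarmVar HarmVar ℂ, T * oscRep A = oscRep A * T) : T * hH = hH * T := by
  have h := comm_osc T hT (Sum.inr ()) (Sum.inr ())
  simp only [osc] at h
  apply LinearMap.ext
  intro f
  have hf := congrArg (fun S : Module.End ℂ HarmModel => S f) h
  simp only [Module.End.mul_apply, LinearMap.neg_apply, map_neg, neg_inj] at hf
  exact hf

/-- hence it commutes with the `U(1)` weight operator and preserves every `F_k` -/
theorem map_mem_hpiece (hT : ∀ A : Matrix HarmVar HarmVar ℂ, T * oscRep A = oscRep A * T) {k : ℤ}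
    {f : HarmModel} (hf : f ∈ hpiece k) : T f ∈ hpiece k := by
  rw [mem_wpiece_iff] at hf ⊢
  have e0 : hE 0 0 (T f) = T (hE 0 0 f) := by
    change (hE 0 0 * T) f = (T * hE 0 0) f
    rw [comm_hE T hT 0 0]
  have e1 : hE 1 1 (T f) = T (hE 1 1 f) := by
    change (hE 1 1 * T) f = (T * hE 1 1) f
    rw [comm_hE T hT 1 1]
  have e2 : hH (T f) = T (hH f) := by
    change (hH * T) f = (T * hH) f
    rw [comm_hH T hT]
  have hw : weightOp uWt (T f) = T (weightOp uWt f) := by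
    rw [weightOp_uWt_eq]
    simp only [LinearMap.sub_apply, LinearMap.add_apply, map_sub, map_add, e0, e1, e2]
  rw [hw, hf, map_smul]

/-- and preserves every `w`-degree layer -/
theorem map_mem_wpiece_hwWt (hT : ∀ A : Matrix HarmVar HarmVar ℂ, T * oscRep A = oscRep A * T) {e : ℤ}
    {f : HarmModel} (hf : f ∈ wpiece hwWt e) : T f ∈ wpiece hwWt e := by
  rw [mem_wpiece_iff] at hf ⊢
  rw [weightOp_hwWt_eq] at hf ⊢
  have e2 : hH (T f) = T (hH f) := by
    change (hH * T) f = (T * hH) f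
    rw [comm_hH T hT]
  rw [e2, hf, map_smul]

/-- an eigenvector of `T` inside `F_k`, found in the finite-dimensional non-zero layer `F_k^{(k⁻)}` -/
theorem exists_eigenvector_mem_hpiece (hT : ∀ A : Matrix HarmVar HarmVar ℂ, T * oscRep A = oscRep A * T) (k : ℤ) :
    ∃ c : ℂ, ∃ v ∈ hpiece k, v ≠ 0 ∧ T v = c • v := by
  have hke : 0 ≤ k + ((-k).toNat : ℕ) := by
    have := Int.self_le_toNat (-k)
    omega
  have hpres : ∀ x ∈ kpiece k (-k).toNat, T x ∈ kpiece k (-k).toNat := fun x hx =>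
    ⟨map_mem_hpiece T hT hx.1, map_mem_wpiece_hwWt T hT hx.2⟩
  haveI : FiniteDimensional ℂ ↥(kpiece k (-k).toNat) := kpiece_finite k _
  haveI : Nontrivial ↥(kpiece k (-k).toNat) :=
    Submodule.nontrivial_iff_ne_bot.mpr ((kpiece_ne_bot_iff k _).mpr hke)
  obtain ⟨c, hc⟩ := Module.End.exists_eigenvalue (T.restrict hpres)
  obtain ⟨v, hv⟩ := hc.exists_hasEigenvector
  refine ⟨c, v, v.2.1, fun h => hv.2 (Subtype.ext h), ?_⟩
  have h := congrArg Subtype.val hv.apply_eq_smul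
  simpa [LinearMap.restrict_apply] using h

/-- **Schur / commutant, one piece**: an operator commuting with `𝔤𝔩₃` acts on each `F_k` by a scalar. -/
theorem commutant_scalar_on_hpiece (hT : ∀ A : Matrix HarmVar HarmVar ℂ, T * oscRep A = oscRep A * T) (k : ℤ) :
    ∃ c : ℂ, ∀ f ∈ hpiece k, T f = c • f := by
  obtain ⟨c, v, hvk, hv0, hTv⟩ := exists_eigenvector_mem_hpiece T hT k
  refine ⟨c, ?_⟩
  let M : Submodule ℂ HarmModel := hpiece k ⊓ LinearMap.ker (T - c • (1 : Module.End ℂ HarmModel))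
  have hmemM : ∀ g : HarmModel, g ∈ M ↔ g ∈ hpiece k ∧ T g = c • g := by
    intro g
    simp only [M, Submodule.mem_inf, LinearMap.mem_ker, LinearMap.sub_apply, LinearMap.smul_apply,
      Module.End.one_apply, sub_eq_zero]
  have hM : ∀ A : Matrix HarmVar HarmVar ℂ, ∀ g ∈ M, oscRep A g ∈ M := by
    intro A g hg
    rw [hmemM] at hg ⊢
    refine ⟨oscRep_mem_hpiece k A g hg.1, ?_⟩
    calc T (oscRep A g) = (T * oscRep A) g := rfl
      _ = (oscRep A * T) g := by rw [hT A]
      _ = c • oscRep A g := by rw [Module.End.mul_apply, hg.2, map_smul]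
  have hle : hpiece k ≤ M := hpiece_le_of_oscRep_stable k M hM ((hmemM v).mpr ⟨hvk, hTv⟩) hv0 hvk
  intro f hf
  exact ((hmemM f).mp (hle hf)).2

/-- conversely an operator acting by scalars on the `F_k` commutes with `𝔤𝔩₃` -/
theorem commutes_of_scalar_on_hpiece (c : ℤ → ℂ) (hTc : ∀ k : ℤ, ∀ f ∈ hpiece k, T f = c k • f)
    (A : Matrix HarmVar HarmVar ℂ) : T * oscRep A = oscRep A * T := by
  apply LinearMap.ext
  intro f
  change T (oscRep A f) = oscRep A (T f)
  have hf : f ∈ ⨆ k : ℤ, hpiece k := by rw [iSup_hpiece_eq_top]; exact Submodule.mem_top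
  refine Submodule.iSup_induction (fun k : ℤ => hpiece k)
    (motive := fun f => T (oscRep A f) = oscRep A (T f)) hf (fun k g hg => ?_) (by simp) ?_
  · rw [hTc k g hg, map_smul, hTc k _ (oscRep_mem_hpiece k A g hg)]
  · intro x y hx hy
    rw [map_add, map_add, map_add, map_add, hx, hy]

/-- **Howe duality, double-commutant form for `(U(1), U(2,1))` on the Fock space**: the commutant of
`oscRep(𝔤𝔩₃(ℂ))` in `End ℂ[z₁,z₂,w]` is exactly the algebra of operators that are a scalar `c_k` on each
`U(1)`-isotypic piece `F_k` — i.e. the (weak closure of the) algebra generated by `U(1)`: the two actions are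
mutual commutants. -/
theorem commutant_iff (T : Module.End ℂ HarmModel) :
    (∀ A : Matrix HarmVar HarmVar ℂ, T * oscRep A = oscRep A * T) ↔
      ∃ c : ℤ → ℂ, ∀ k : ℤ, ∀ f ∈ hpiece k, T f = c k • f := by
  constructor
  · intro hT
    choose c hc using fun k => commutant_scalar_on_hpiece T hT k
    exact ⟨c, hc⟩
  · rintro ⟨c, hc⟩
    exact commutes_of_scalar_on_hpiece T c hc

/-- in particular (`Schur`): a `𝔤𝔩₃`-commuting operator preserving nothing more is scalar on the irreducible `F_k`;
and `End_{𝔤𝔩₃}(F_k) = ℂ`: any `𝔤𝔩₃`-commuting operator agrees on `F_k` with a scalar. -/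
theorem commutant_sub_smul_eq_zero_on_hpiece (hT : ∀ A : Matrix HarmVar HarmVar ℂ, T * oscRep A = oscRep A * T)
    (k : ℤ) : ∃ c : ℂ, ∀ f ∈ hpiece k, (T - c • (1 : Module.End ℂ HarmModel)) f = 0 := by
  obtain ⟨c, hc⟩ := commutant_scalar_on_hpiece T hT k
  exact ⟨c, fun f hf => by simp [hc f hf]⟩

end Commutant

section CommutantDef
attribute [local instance 100] LieRing.ofAssociativeRing

/-- the Euler (degree) operator of `ℂ[z₁,z₂,z₃]` is `dERep 1 = E₀₀ + E₁₁ + E₂₂` -/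
theorem weightOp_one_eq_def : (weightOp (fun _ : Fin 3 => (1 : ℤ)) : DefModel →ₗ[ℂ] DefModel) = dE 0 0 + dE 1 1 + dE 2 2 := by
  apply LinearMap.ext
  intro f
  rw [weightOp_apply, Fin.sum_univ_three]
  simp only [LinearMap.add_apply]
  simp only [dE_apply, Int.cast_one, one_smul]

variable (T : Module.End ℂ DefModel)

/-- (Ported verbatim from the HodgeCMPerL package; no docstring in the source.) -/
theorem comm_dE (hT : ∀ A : Matrix (Fin 3) (Fin 3) ℂ, T * dERep A = dERep A * T) (a b : Fin 3) :
    T * dE a b = dE a b * T := by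
  have h := hT (Matrix.single a b 1)
  rwa [dERep_single] at h

/-- a `𝔤𝔩₃`-commuting operator preserves every `Sym^d` -/
theorem map_mem_dpiece (hT : ∀ A : Matrix (Fin 3) (Fin 3) ℂ, T * dERep A = dERep A * T) {d : ℕ}
    {f : DefModel} (hf : f ∈ dpiece d) : T f ∈ dpiece d := by
  rw [mem_wpiece_iff] at hf ⊢
  have e : ∀ a : Fin 3, dE a a (T f) = T (dE a a f) := fun a => by
    change (dE a a * T) f = (T * dE a a) f
    rw [comm_dE T hT a a]
  have hw : weightOp (fun _ : Fin 3 => (1 : ℤ)) (T f) = T (weightOp (fun _ : Fin 3 => (1 : ℤ)) f) := by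
    rw [weightOp_one_eq_def]
    simp only [LinearMap.add_apply, map_add, e]
  rw [hw, hf, map_smul]

/-- **Schur, definite pair**: a `𝔤𝔩₃`-commuting operator acts on each `Sym^d` by a scalar. -/
theorem commutant_scalar_on_dpiece (hT : ∀ A : Matrix (Fin 3) (Fin 3) ℂ, T * dERep A = dERep A * T) (d : ℕ) :
    ∃ c : ℂ, ∀ f ∈ dpiece d, T f = c • f := by
  have hpres : ∀ x ∈ dpiece d, T x ∈ dpiece d := fun x hx => map_mem_dpiece T hT hx
  haveI : FiniteDimensional ℂ ↥(dpiece d) := dpiece_finite d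
  haveI : Nontrivial ↥(dpiece d) := Submodule.nontrivial_iff_ne_bot.mpr (dpiece_ne_bot d)
  obtain ⟨c, hc⟩ := Module.End.exists_eigenvalue (T.restrict hpres)
  obtain ⟨v, hv⟩ := hc.exists_hasEigenvector
  have hTv : T v = c • (v : DefModel) := by
    have h := congrArg Subtype.val hv.apply_eq_smul
    simpa [LinearMap.restrict_apply] using h
  have hv0 : (v : DefModel) ≠ 0 := fun h => hv.2 (Subtype.ext h)
  refine ⟨c, ?_⟩
  let M : Submodule ℂ DefModel := dpiece d ⊓ LinearMap.ker (T - c • (1 : Module.End ℂ DefModel))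
  have hmemM : ∀ g : DefModel, g ∈ M ↔ g ∈ dpiece d ∧ T g = c • g := by
    intro g
    simp only [M, Submodule.mem_inf, LinearMap.mem_ker, LinearMap.sub_apply, LinearMap.smul_apply,
      Module.End.one_apply, sub_eq_zero]
  have hM : ∀ A : Matrix (Fin 3) (Fin 3) ℂ, ∀ g ∈ M, dERep A g ∈ M := by
    intro A g hg
    rw [hmemM] at hg ⊢
    refine ⟨dERep_mem_dpiece d A g hg.1, ?_⟩
    calc T (dERep A g) = (T * dERep A) g := rfl
      _ = (dERep A * T) g := by rw [hT A]
      _ = c • dERep A g := by rw [Module.End.mul_apply, hg.2, map_smul]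
  have hle : dpiece d ≤ M := dpiece_le_of_dERep_stable d M hM ((hmemM v).mpr ⟨v.2, hTv⟩) hv0 v.2
  intro f hf
  exact ((hmemM f).mp (hle hf)).2

/-- (Ported verbatim from the HodgeCMPerL package; no docstring in the source.) -/
theorem commutes_of_scalar_on_dpiece (c : ℕ → ℂ) (hTc : ∀ d : ℕ, ∀ f ∈ dpiece d, T f = c d • f)
    (A : Matrix (Fin 3) (Fin 3) ℂ) : T * dERep A = dERep A * T := by
  apply LinearMap.ext
  intro f
  change T (dERep A f) = dERep A (T f)
  have hf : f ∈ ⨆ d : ℕ, dpiece d := by rw [dpiece_isInternal.submodule_iSup_eq_top]; exact Submodule.mem_top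
  refine Submodule.iSup_induction (fun d : ℕ => dpiece d)
    (motive := fun f => T (dERep A f) = dERep A (T f)) hf (fun d g hg => ?_) (by simp) ?_
  · rw [hTc d g hg, map_smul, hTc d _ (dERep_mem_dpiece d A g hg)]
  · intro x y hx hy
    rw [map_add, map_add, map_add, map_add, hx, hy]

/-- **double commutant, definite pair `(U(1), U(3))`**: the commutant of `dERep(𝔤𝔩₃(ℂ))` in `End ℂ[z₁,z₂,z₃]` is the
algebra of operators scalar on each `Sym^d` (= generated by the `U(1)` scaling action). -/
theorem commutant_iff_def (T : Module.End ℂ DefModel) :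
    (∀ A : Matrix (Fin 3) (Fin 3) ℂ, T * dERep A = dERep A * T) ↔
      ∃ c : ℕ → ℂ, ∀ d : ℕ, ∀ f ∈ dpiece d, T f = c d • f := by
  constructor
  · intro hT
    choose c hc using fun d => commutant_scalar_on_dpiece T hT d
    exact ⟨c, hc⟩
  · rintro ⟨c, hc⟩
    exact commutes_of_scalar_on_dpiece T c hc

end CommutantDef

section CommutantAbelian
attribute [local instance 100] LieRing.ofAssociativeRing

/-- **multiplicity-freeness in commutant form**: the commutant of `oscRep(𝔤𝔩₃)` is commutative. -/
theorem commutant_commutative (T₁ T₂ : Module.End ℂ HarmModel)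
    (h₁ : ∀ A : Matrix HarmVar HarmVar ℂ, T₁ * oscRep A = oscRep A * T₁)
    (h₂ : ∀ A : Matrix HarmVar HarmVar ℂ, T₂ * oscRep A = oscRep A * T₂) : T₁ * T₂ = T₂ * T₁ := by
  obtain ⟨c₁, hc₁⟩ := (commutant_iff T₁).mp h₁
  obtain ⟨c₂, hc₂⟩ := (commutant_iff T₂).mp h₂
  apply LinearMap.ext
  intro f
  change T₁ (T₂ f) = T₂ (T₁ f)
  have hf : f ∈ ⨆ k : ℤ, hpiece k := by rw [iSup_hpiece_eq_top]; exact Submodule.mem_top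
  refine Submodule.iSup_induction (fun k : ℤ => hpiece k)
    (motive := fun f => T₁ (T₂ f) = T₂ (T₁ f)) hf (fun k g hg => ?_) (by simp) ?_
  · rw [hc₂ k g hg, map_smul, hc₁ k g hg, map_smul, hc₂ k g hg, smul_smul, smul_smul, mul_comm]
  · intro x y hx hy
    rw [map_add, map_add, map_add, map_add, hx, hy]

/-- definite pair: the commutant of `dERep(𝔤𝔩₃)` is commutative (`ℂ[z₁,z₂,z₃]` is multiplicity-free). -/
theorem commutant_commutative_def (T₁ T₂ : Module.End ℂ DefModel)
    (h₁ : ∀ A : Matrix (Fin 3) (Fin 3) ℂ, T₁ * dERep A = dERep A * T₁)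
    (h₂ : ∀ A : Matrix (Fin 3) (Fin 3) ℂ, T₂ * dERep A = dERep A * T₂) : T₁ * T₂ = T₂ * T₁ := by
  obtain ⟨c₁, hc₁⟩ := (commutant_iff_def T₁).mp h₁
  obtain ⟨c₂, hc₂⟩ := (commutant_iff_def T₂).mp h₂
  apply LinearMap.ext
  intro f
  change T₁ (T₂ f) = T₂ (T₁ f)
  have hf : f ∈ ⨆ d : ℕ, dpiece d := by rw [dpiece_isInternal.submodule_iSup_eq_top]; exact Submodule.mem_top
  refine Submodule.iSup_induction (fun d : ℕ => dpiece d)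
    (motive := fun f => T₁ (T₂ f) = T₂ (T₁ f)) hf (fun d g hg => ?_) (by simp) ?_
  · rw [hc₂ d g hg, map_smul, hc₁ d g hg, map_smul, hc₂ d g hg, smul_smul, smul_smul, mul_comm]
  · intro x y hx hy
    rw [map_add, map_add, map_add, map_add, hx, hy]

/-- and the `U(1)` weight operator itself lies in the commutant (so the commutant is exactly the bicommutant of `U(1)`):
`Z` commutes with `oscRep(𝔤𝔩₃)`. -/
theorem weightOp_uWt_comm_oscRep (A : Matrix HarmVar HarmVar ℂ) :
    (weightOp uWt : Module.End ℂ HarmModel) * oscRep A = oscRep A * weightOp uWt :=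
  commutes_of_scalar_on_hpiece _ (fun k => (k : ℂ)) (fun k f hf => (mem_wpiece_iff uWt k f).mp hf) A

end CommutantAbelian

end HodgeCM.PerL34.Fock
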